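import Mathlib

/-!
# Colour-cell universality: the block blow-up `𝔖ₘ →* 𝔖ₘₛ` (tool for line `schur-weyl-colour-cells`)

Crux `LevelGradedCohnUmans.GradedDesignFamily` (stmt-MatrixMultiplication-7610), line
`schur-weyl-colour-cells`, registered stub `colourSeparated_blowup`.

The `r`-colour cell of `𝔖ₘ` is `J_r(m) = span{ g ↦ [c' ∘ g = c] : c, c' : [m] → [r] }`.  The
**blow-up** `ι : 𝔖ₘ →* 𝔖ₘₛ` replaces every point of `[m]` by a block of `s` points
(`(i, j) ↦ (g i, j)` on `[m] × [s] ≃ [m s]`).  Writing an `r`-colouring (`r ≤ 2 ^ s`) in binary,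
one bit per point of the block, turns every generator `[c' ∘ g = c]` of `J_r(m)` into the pull-back
`G ↦ [C' ∘ G = C]` along `ι` of a generator of the TWO-colour cell `J_2(m s)`; hence every
`J_r(m)`-separating function of a triple `X, Y, Z ⊆ 𝔖ₘ` is the pull-back of a `J_2(m s)`-separating
function of the blown-up triple `ι X, ι Y, ι Z` (same volume, `ι` an injective hom).  This is the
separation clause of `GradedDesignFamily` at `J = J_2`, verbatim, for the image triple.

The proof is elementary and explicit: the hom is `finProdFinEquiv.permCongr (g × 1)`, the encoding
is any injection `Fin r ↪ (Fin s → Fin 2)` (it exists because `r ≤ 2 ^ s = #(Fin s → Fin 2)`), and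
the span transfer is `Submodule.map_span` for the pull-back linear map `LinearMap.funLeft`.
-/

noncomputable section

set_option linter.dupNamespace false

namespace Summit.MatrixMultiplication.MatrixMultiplication.Theorems.GradedDesignFamily.ColourCellBitBlowup

/-- **Colour-cell universality (blow-up).**  For `1 ≤ s` and `r ≤ 2 ^ s` there is an injective
group hom `ι : 𝔖ₘ →* 𝔖ₘₛ` (points ↦ blocks of `s` points) carrying every `J_r(m)`-separated triple
`X, Y, Z ⊆ 𝔖ₘ` to a `J_2(m s)`-separated triple `ι X, ι Y, ι Z`: the separation clause of
`GradedDesignFamily` for the two-colour cell `J_2 = span{[c' ∘ g = c] : c, c' : [m s] → [2]}` holds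
verbatim for the image triple. [folklore; binary encoding of colours] -/
theorem colourSeparated_blowup (m s r : ℕ) (hs : 1 ≤ s) (hr : r ≤ 2 ^ s)
    (X Y Z : Finset (Equiv.Perm (Fin m)))
    (hsep : ∀ x₀ ∈ X, ∀ z₀ ∈ Z, ∃ f ∈ Submodule.span ℂ {f : Equiv.Perm (Fin m) → ℂ |
        ∃ c c' : Fin m → Fin r, f = fun g : Equiv.Perm (Fin m) => if c' ∘ (⇑g) = c then (1 : ℂ) else 0},
      ∀ x ∈ X, ∀ y ∈ Y, ∀ y' ∈ Y, ∀ z ∈ Z,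
        (x = x₀ ∧ y = y' ∧ z = z₀ → f (x⁻¹ * y * y'⁻¹ * z) = 1) ∧
        (¬ (x = x₀ ∧ y = y' ∧ z = z₀) → f (x⁻¹ * y * y'⁻¹ * z) = 0)) :
    ∃ ι : Equiv.Perm (Fin m) →* Equiv.Perm (Fin (m * s)), Function.Injective ι ∧
      ∀ x₀ ∈ X.image ι, ∀ z₀ ∈ Z.image ι, ∃ f ∈ Submodule.span ℂ {f : Equiv.Perm (Fin (m * s)) → ℂ |
          ∃ c c' : Fin (m * s) → Fin 2,
            f = fun g : Equiv.Perm (Fin (m * s)) => if c' ∘ (⇑g) = c then (1 : ℂ) else 0},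
        ∀ x ∈ X.image ι, ∀ y ∈ Y.image ι, ∀ y' ∈ Y.image ι, ∀ z ∈ Z.image ι,
          (x = x₀ ∧ y = y' ∧ z = z₀ → f (x⁻¹ * y * y'⁻¹ * z) = 1) ∧
          (¬ (x = x₀ ∧ y = y' ∧ z = z₀) → f (x⁻¹ * y * y'⁻¹ * z) = 0) := by
  -- Step 1: the blow-up hom `g ↦ (i, j) ↦ (g i, j)`, transported along `Fin m × Fin s ≃ Fin (m * s)`,
  -- characterised by its action on block coordinates.
  obtain ⟨ι, hι⟩ : ∃ ι : Equiv.Perm (Fin m) →* Equiv.Perm (Fin (m * s)),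
      ∀ g : Equiv.Perm (Fin m), ∀ p : Fin m × Fin s,
        ι g (finProdFinEquiv p) = finProdFinEquiv (g p.1, p.2) := by
    refine ⟨MonoidHom.mk' (fun g => (finProdFinEquiv (m := m) (n := s)).permCongr
        (Equiv.prodCongr g (Equiv.refl (Fin s)))) ?_, ?_⟩
    · intro g h
      refine Equiv.ext fun k => ?_
      obtain ⟨⟨i, j⟩, rfl⟩ := finProdFinEquiv.surjective k
      simp [Equiv.permCongr_apply, Equiv.Perm.mul_apply]
    · rintro g ⟨i, j⟩
      simp [Equiv.permCongr_apply]
  -- Step 2: `ι` is injective (here `1 ≤ s` is used: the block coordinate `0 : Fin s` exists).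
  have hinj : Function.Injective ι := by
    intro g h hgh
    refine Equiv.ext fun i => ?_
    have key := congrArg (fun σ : Equiv.Perm (Fin (m * s)) => σ (finProdFinEquiv (i, (⟨0, hs⟩ : Fin s))))
      hgh
    simp only [hι] at key
    have key' := finProdFinEquiv.injective key
    simp only [Prod.mk.injEq, and_true] at key'
    exact key'
  -- Step 3: binary encoding of the `r ≤ 2 ^ s` colours by `s` bits, and the lifted colourings.
  obtain ⟨enc⟩ : Nonempty (Fin r ↪ (Fin s → Fin 2)) :=
    Function.Embedding.nonempty_of_card_le (by simpa using hr)
  obtain ⟨lift, hlift⟩ : ∃ lift : (Fin m → Fin r) → (Fin (m * s) → Fin 2),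
      ∀ c : Fin m → Fin r, ∀ p : Fin m × Fin s, lift c (finProdFinEquiv p) = enc (c p.1) p.2 :=
    ⟨fun c k => enc (c (finProdFinEquiv.symm k).1) (finProdFinEquiv.symm k).2, fun c p => by simp⟩
  have hkey : ∀ (c c' : Fin m → Fin r) (g : Equiv.Perm (Fin m)),
      (lift c' ∘ ⇑(ι g) = lift c) ↔ (c' ∘ ⇑g = c) := by
    intro c c' g
    constructor
    · intro h
      funext i
      apply enc.injective
      funext j
      have hij := congrFun h (finProdFinEquiv (i, j))
      simpa [hι, hlift] using hij
    · intro h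
      funext k
      obtain ⟨⟨i, j⟩, rfl⟩ := finProdFinEquiv.surjective k
      have hi : c' (g i) = c i := congrFun h i
      simp [hι, hlift, hi]
  -- Step 4: every generator of `J_r(m)` is the pull-back along `ι` of a generator of `J_2(m s)`,
  -- hence (linearity of pull-back) so is every element of the span.
  have hgen : ∀ f ∈ {f : Equiv.Perm (Fin m) → ℂ |
        ∃ c c' : Fin m → Fin r, f = fun g : Equiv.Perm (Fin m) => if c' ∘ (⇑g) = c then (1 : ℂ) else 0},
      ∃ F ∈ {f : Equiv.Perm (Fin (m * s)) → ℂ | ∃ c c' : Fin (m * s) → Fin 2,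
        f = fun g : Equiv.Perm (Fin (m * s)) => if c' ∘ (⇑g) = c then (1 : ℂ) else 0},
      F ∘ ⇑ι = f := by
    rintro f ⟨c, c', rfl⟩
    refine ⟨fun G => if lift c' ∘ (⇑G) = lift c then (1 : ℂ) else 0, ⟨lift c, lift c', rfl⟩, ?_⟩
    funext g
    simp only [Function.comp_apply]
    by_cases h : c' ∘ ⇑g = c
    · rw [if_pos h, if_pos ((hkey c c' g).2 h)]
    · rw [if_neg h, if_neg (fun h' => h ((hkey c c' g).1 h'))]
  have htrans : ∀ f ∈ Submodule.span ℂ {f : Equiv.Perm (Fin m) → ℂ |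
        ∃ c c' : Fin m → Fin r, f = fun g : Equiv.Perm (Fin m) => if c' ∘ (⇑g) = c then (1 : ℂ) else 0},
      ∃ F ∈ Submodule.span ℂ {f : Equiv.Perm (Fin (m * s)) → ℂ | ∃ c c' : Fin (m * s) → Fin 2,
        f = fun g : Equiv.Perm (Fin (m * s)) => if c' ∘ (⇑g) = c then (1 : ℂ) else 0},
      F ∘ ⇑ι = f := by
    intro f hf
    set Φ : (Equiv.Perm (Fin (m * s)) → ℂ) →ₗ[ℂ] (Equiv.Perm (Fin m) → ℂ) :=
      LinearMap.funLeft ℂ ℂ (⇑ι)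
    have hle := Submodule.span_mono (R := ℂ) (fun f hf => show f ∈ Φ '' _ from by
      obtain ⟨F, hF, hFf⟩ := hgen f hf
      exact ⟨F, hF, hFf⟩) hf
    rw [← Submodule.map_span] at hle
    obtain ⟨F, hF, hFf⟩ := Submodule.mem_map.1 hle
    exact ⟨F, hF, hFf⟩
  -- Step 5: transport the separation clause through the injective hom `ι`.
  refine ⟨ι, hinj, ?_⟩
  intro x₀ hx₀ z₀ hz₀
  obtain ⟨x₁, hx₁, rfl⟩ := Finset.mem_image.1 hx₀
  obtain ⟨z₁, hz₁, rfl⟩ := Finset.mem_image.1 hz₀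
  obtain ⟨f, hf, hfsep⟩ := hsep x₁ hx₁ z₁ hz₁
  obtain ⟨F, hF, rfl⟩ := htrans f hf
  refine ⟨F, hF, ?_⟩
  intro x hx y hy y' hy' z hz
  obtain ⟨x₂, hx₂, rfl⟩ := Finset.mem_image.1 hx
  obtain ⟨y₂, hy₂, rfl⟩ := Finset.mem_image.1 hy
  obtain ⟨y₃, hy₃, rfl⟩ := Finset.mem_image.1 hy'
  obtain ⟨z₂, hz₂, rfl⟩ := Finset.mem_image.1 hz
  have hval : F ((ι x₂)⁻¹ * ι y₂ * (ι y₃)⁻¹ * ι z₂) = (F ∘ ⇑ι) (x₂⁻¹ * y₂ * y₃⁻¹ * z₂) := by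
    simp only [Function.comp_apply, map_mul, map_inv]
  have hiff : (ι x₂ = ι x₁ ∧ ι y₂ = ι y₃ ∧ ι z₂ = ι z₁) ↔ (x₂ = x₁ ∧ y₂ = y₃ ∧ z₂ = z₁) := by
    simp only [hinj.eq_iff]
  obtain ⟨h1, h2⟩ := hfsep x₂ hx₂ y₂ hy₂ y₃ hy₃ z₂ hz₂
  exact ⟨fun h => hval.trans (h1 (hiff.1 h)), fun h => hval.trans (h2 fun h' => h (hiff.2 h'))⟩

end Summit.MatrixMultiplication.MatrixMultiplication.Theorems.GradedDesignFamily.ColourCellBitBlowup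

end
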